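import Literature.AnabelianGeometry.AbsoluteAnabelian.MonoidKummerLimitNaturality
import Literature.AnabelianGeometry.AbsoluteAnabelian.MonoidKummerTransportCanonical

/-!
# [AbsTopIII] Prop 3.2 (ii): naturality of the COLIMIT Kummer map `M_TM → lim→_J H¹(J, μ_Ẑ(M_TM))` on ABSTRACT
# MLF-Galois `TM`-pairs (model presentations)

S. Mochizuki, *Topics in absolute anabelian geometry III*, §3, Prop. 3.2 (ii) p. 71 ("a functorial algorithm for
constructing … the Kummer maps … `M_TM → lim→_J H¹(J, μ_Ẑ(M_TM))`"; bib key `MochizukiAbsTopIII2015`, kurims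
pages, lit key `paper:url-5493eb38cbb7`).

`MonoidKummerLimitNaturality.lean` (seat abc-iut-L4-t2) proves the colimit naturality at the MODEL
(`ModelMLFGaloisData.kummerGrp_natural`: `pullLim (κ^lim₂(φ_M m)) = pushLim (κ^lim₁ m)`).  Here the same for the
Kummer theories `π.kummerTheory` of model PRESENTATIONS of abstract pairs (`MonoidKummerTransportCanonical.lean`),
whose cohomology data are the TRANSPORTED ones (`ContCohomologyData.transport`: `lim→` over the open subgroups
of the abstract `Π`, members `H¹(e⁻¹J, Λ(k̄ˣ))`):

* `ModelMLFGaloisData.pullLimT c hc e₂` / `pushLimT c e₁` — the colimit pull-back / push-forward out of the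
  TRANSPORTED direct limits `lim→_{J ⊆ Π} H¹(e⁻¹J, ·)` into the comparison direct limit `lim→_{J₁ ⊆ Π_k}
  H¹(J₁, res_φ Λ(k̄'ˣ))` (`AddCommGroup.DirectLimit.lift`; index change `J ↦ φ⁻¹(e'⁻¹J)` resp. `J ↦ e⁻¹J`),
  with `_ofGrp` rules reducing them to the model maps `pullLim` / `pushLim`;
* **`GaloisMonoidPair.ModelPresentation.kummerGrp_natural`** — for every morphism `f : (Π ↷ M) → (Π' ↷ M')` of
  abstract pairs (Def. 3.1 (ii)) with presentations `π`, `π'` and every `m ∈ M`: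
  `pullLimT (κ'^lim(f_M m)) = pushLimT (κ^lim(m))` along the transition pair `(e'⁻¹ f_Π e, e'⁻¹ f_M e)`.

Universe `0`.  HONEST FRAMING: classical Kummer theory; nothing here bears on [IUTchIII] Cor. 3.12; no side taken.
-/

noncomputable section

namespace Literature.AnabelianGeometry.AbsoluteAnabelian

open Literature.AnabelianGeometry.EtaleTheta (kummerClass invariants cyclotomeRep EquivariantMorphism resH1)

/-! ### Colimit maps out of transported cohomology data -/

namespace ModelMLFGaloisData

variable {C₁ C₂ : MLFClosure.{0}} {D₁ : ModelMLFGaloisData C₁.k C₁.K} {D₂ : ModelMLFGaloisData C₂.k C₂.K}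
  (c : EquivariantMorphism D₁.Pi (C₁.K)ˣ D₂.Pi (C₂.K)ˣ) (hc : Continuous c.groupHom)
  {P₁ P₂ : Type} [Group P₁] [TopologicalSpace P₁] [Group P₂] [TopologicalSpace P₂]
  (e₁ : D₁.Pi ≃ₜ* P₁) (e₂ : D₂.Pi ≃ₜ* P₂)

/-- The restriction maps of transported model cohomology data are the `resH1` of the pulled-back levels
(definitional). [cite: MochizukiAbsTopIII2015, Proposition 3.2 (ii) p.71] -/
theorem transport_kummerCohomology_res {C : MLFClosure.{0}} {D : ModelMLFGaloisData C.k C.K} {P : Type}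
    [Group P] [TopologicalSpace P] (e : D.Pi ≃ₜ* P) {H J : OpenSubgroup P} (h : J ≤ H)
    (x : ((D.kummerCohomology C).transport e).H1 H) :
    ((D.kummerCohomology C).transport e).res h x =
      resH1 (A := (C.K)ˣ) (G := D.Pi) (ContCohomologyData.comap_mono e h) x :=
  rfl

/-- **Colimit pull-back out of TRANSPORTED data**: `lim→_{J ⊆ P₂} H¹(e₂⁻¹J, Λ(k̄₂ˣ)) →+ lim→_{J₁ ⊆ Π₁} H¹(J₁, res_φ Λ(k̄₂ˣ))`,
`[x]_J ↦ [pullTop x]_{φ⁻¹(e₂⁻¹J)}`. [cite: MochizukiAbsTopIII2015, Proposition 3.2 (ii) p.71] -/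
def pullLimT : ((D₂.kummerCohomology C₂).transport e₂).H1LimGrp →+ (resCohomology c).H1LimGrp :=
  AddCommGroup.DirectLimit.lift _ _ _
    (fun i => ((resCohomology c).ofGrp
        (comapOpen' c hc (i.J.comap e₂.toMonoidHom e₂.continuous))).comp
      (c.pullTop ((i.J.comap e₂.toMonoidHom e₂.continuous : OpenSubgroup D₂.Pi) :
        Subgroup D₂.Pi)).hom.toAddMonoidHom)
    (fun i j hij x => by
      have hle : j.J.comap e₂.toMonoidHom e₂.continuous ≤ i.J.comap e₂.toMonoidHom e₂.continuous :=
        ContCohomologyData.comap_mono e₂ (ContCohomologyData.LimIdx.le_iff.mp hij)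
      change (resCohomology c).ofGrp (comapOpen' c hc (j.J.comap e₂.toMonoidHom e₂.continuous))
          (c.pullTop ((j.J.comap e₂.toMonoidHom e₂.continuous : OpenSubgroup D₂.Pi) : Subgroup D₂.Pi)
            (((D₂.kummerCohomology C₂).transport e₂).res (ContCohomologyData.LimIdx.le_iff.mp hij) x)) =
        (resCohomology c).ofGrp (comapOpen' c hc (i.J.comap e₂.toMonoidHom e₂.continuous))
          (c.pullTop ((i.J.comap e₂.toMonoidHom e₂.continuous : OpenSubgroup D₂.Pi) : Subgroup D₂.Pi) x)
      rw [transport_kummerCohomology_res, ← c.resTop_pullTop hle x]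
      exact (resCohomology c).ofGrp_res (H := comapOpen' c hc _) (J := comapOpen' c hc _)
        (fun g hg => hle hg) _)

/-- `pullLimT` on a class at level `J` is the MODEL `pullLim` on the class at level `e₂⁻¹J`.
[cite: MochizukiAbsTopIII2015, Proposition 3.2 (ii) p.71] -/
@[simp] theorem pullLimT_ofGrp (J : OpenSubgroup P₂)
    (x : ((D₂.kummerCohomology C₂).transport e₂).H1 J) :
    pullLimT c hc e₂ (((D₂.kummerCohomology C₂).transport e₂).ofGrp J x) =
      pullLim c hc ((D₂.kummerCohomology C₂).ofGrp (J.comap e₂.toMonoidHom e₂.continuous) x) := by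
  rw [pullLim_ofGrp]
  exact AddCommGroup.DirectLimit.lift_of _ _ _ _ _

/-- **Colimit push-forward out of TRANSPORTED data**: `lim→_{J ⊆ P₁} H¹(e₁⁻¹J, Λ(k̄₁ˣ)) →+ lim→_{J₁ ⊆ Π₁} H¹(J₁, res_φ Λ(k̄₂ˣ))`,
`[x]_J ↦ [pushTop x]_{e₁⁻¹J}`. [cite: MochizukiAbsTopIII2015, Proposition 3.2 (ii) p.71] -/
def pushLimT : ((D₁.kummerCohomology C₁).transport e₁).H1LimGrp →+ (resCohomology c).H1LimGrp :=
  AddCommGroup.DirectLimit.lift _ _ _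
    (fun i => ((resCohomology c).ofGrp (i.J.comap e₁.toMonoidHom e₁.continuous)).comp
      (c.pushTop ((i.J.comap e₁.toMonoidHom e₁.continuous : OpenSubgroup D₁.Pi) :
        Subgroup D₁.Pi)).hom.toAddMonoidHom)
    (fun i j hij x => by
      have hle : j.J.comap e₁.toMonoidHom e₁.continuous ≤ i.J.comap e₁.toMonoidHom e₁.continuous :=
        ContCohomologyData.comap_mono e₁ (ContCohomologyData.LimIdx.le_iff.mp hij)
      change (resCohomology c).ofGrp (j.J.comap e₁.toMonoidHom e₁.continuous)
          (c.pushTop ((j.J.comap e₁.toMonoidHom e₁.continuous : OpenSubgroup D₁.Pi) : Subgroup D₁.Pi)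
            (((D₁.kummerCohomology C₁).transport e₁).res (ContCohomologyData.LimIdx.le_iff.mp hij) x)) =
        (resCohomology c).ofGrp (i.J.comap e₁.toMonoidHom e₁.continuous)
          (c.pushTop ((i.J.comap e₁.toMonoidHom e₁.continuous : OpenSubgroup D₁.Pi) : Subgroup D₁.Pi) x)
      rw [transport_kummerCohomology_res, ← c.resTop_pushTop hle x]
      exact (resCohomology c).ofGrp_res hle _)

/-- `pushLimT` on a class at level `J` is the MODEL `pushLim` on the class at level `e₁⁻¹J`.
[cite: MochizukiAbsTopIII2015, Proposition 3.2 (ii) p.71] -/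
@[simp] theorem pushLimT_ofGrp (J : OpenSubgroup P₁)
    (x : ((D₁.kummerCohomology C₁).transport e₁).H1 J) :
    pushLimT c e₁ (((D₁.kummerCohomology C₁).transport e₁).ofGrp J x) =
      pushLim c ((D₁.kummerCohomology C₁).ofGrp (J.comap e₁.toMonoidHom e₁.continuous) x) := by
  rw [pushLim_ofGrp]
  exact AddCommGroup.DirectLimit.lift_of _ _ _ _ _

end ModelMLFGaloisData

/-! ### Prop 3.2 (ii), colimit form, on abstract pairs -/

namespace GaloisMonoidPair.ModelPresentation

variable {P Q : GaloisMonoidPair.{0}} (f : GaloisMonoidPair.Hom P Q)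
  (π : P.ModelPresentation) (ϖ : Q.ModelPresentation)

/-- The transition homomorphism `e'⁻¹ f_Π e` is continuous. [cite: MochizukiAbsTopIII2015, Definition 3.1 (ii) p.67] -/
theorem continuous_transitionPi : Continuous (transitionPi f π ϖ) :=
  (ϖ.iso.isoPi.symm.continuous.comp f.continuous_homPi).comp π.iso.isoPi.continuous

/-- The group isomorphism `e_Π : Π_k ⥲ Π` of a presentation, typed on `Π_k = D.Pi` (same term as `π.iso.isoPi`).
[cite: MochizukiAbsTopIII2015, Definition 3.1 (ii) p.67] -/
abbrev isoPi (π : P.ModelPresentation) : π.D.Pi ≃ₜ* P.Pi := π.iso.isoPi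

/-- The cohomology data of `π.kummerTheory` ARE the transported model data (definitional).
[cite: MochizukiAbsTopIII2015, Proposition 3.2 (ii) p.71] -/
theorem kummerTheory_coh :
    π.kummerTheory.coh = (π.D.kummerCohomology π.C).transport π.isoPi := rfl

/-- **[AbsTopIII] Prop 3.2 (ii), colimit form, on ABSTRACT MLF-Galois `TM`-pairs.**  For a morphism
`f = (f_Π, f_M) : (Π ↷ M) → (Π' ↷ M')` of pairs (Def. 3.1 (ii)) with model presentations `π = (k, e)`,
`π' = (k', e')` and every `m ∈ M`, the colimit Kummer classes `κ^lim(m) ∈ lim→_J H¹(e⁻¹J, Λ(k̄ˣ))`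
(`MonoidKummerTheory.kummerGrp` of `π.kummerTheory`) and `κ'^lim(f_M m)` satisfy
`pullLimT (κ'^lim(f_M m)) = pushLimT (κ^lim(m))` along the transition pair `(e'⁻¹ f_Π e, e'⁻¹ f_M e)`
("… a functorial algorithm for constructing … `M_TM → lim→_J H¹(J, μ_Ẑ(M_TM))`").
[cite: MochizukiAbsTopIII2015, Proposition 3.2 (ii) p.71] -/
theorem kummerGrp_natural (m : P.M) :
    ModelMLFGaloisData.pullLimT (transitionMorphism f π ϖ) (continuous_transitionPi f π ϖ) ϖ.isoPi
        (ϖ.kummerTheory.kummerGrp (f.homM m)) =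
      ModelMLFGaloisData.pushLimT (transitionMorphism f π ϖ) π.isoPi (π.kummerTheory.kummerGrp m) := by
  have hm : ∀ h : P.stabilizerOpen m, (h : P.Pi) • m = m := fun h => (P.mem_stabilizerOpen_iff m h).mp h.2
  have hm' : ∀ h : Q.stabilizerOpen (f.homM m), (h : Q.Pi) • f.homM m = f.homM m :=
    fun h => (Q.mem_stabilizerOpen_iff _ h).mp h.2
  rw [ϖ.kummerTheory.kummerGrp_eq_ofGrp (f.homM m) (Q.stabilizerOpen (f.homM m)) hm',
    π.kummerTheory.kummerGrp_eq_ofGrp m (P.stabilizerOpen m) hm, kummerTheory_kummer, kummerTheory_kummer]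
  change ModelMLFGaloisData.pullLimT (transitionMorphism f π ϖ) (continuous_transitionPi f π ϖ) ϖ.isoPi
      (((ϖ.D.kummerCohomology ϖ.C).transport ϖ.isoPi).ofGrp (Q.stabilizerOpen (f.homM m))
        ((ϖ.D.kummerTheory ϖ.C).kummer (ϖ.comapOpen (Q.stabilizerOpen (f.homM m)))
          ⟨ϖ.iso.isoM.symm (f.homM m), fun g => ϖ.iso.smul_symm_eq_of_mem_comap hm' g⟩)) =
    ModelMLFGaloisData.pushLimT (transitionMorphism f π ϖ) π.isoPi
      (((π.D.kummerCohomology π.C).transport π.isoPi).ofGrp (P.stabilizerOpen m)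
        ((π.D.kummerTheory π.C).kummer (π.comapOpen (P.stabilizerOpen m))
          ⟨π.iso.isoM.symm m, fun g => π.iso.smul_symm_eq_of_mem_comap hm g⟩))
  rw [ModelMLFGaloisData.pullLimT_ofGrp, ModelMLFGaloisData.pushLimT_ofGrp,
    ModelMLFGaloisData.kummerTheory_kummer, ModelMLFGaloisData.kummerTheory_kummer]
  refine ModelMLFGaloisData.pullLim_kummerClass (transitionMorphism f π ϖ) (continuous_transitionPi f π ϖ)
    _ _ (π.D.invariantUnit π.C _ _) (ϖ.D.invariantUnit ϖ.C _ _) ?_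
  change ModelMLFGaloisData.unitsLift (transitionM f π ϖ) (ModelMLFGaloisData.toUnit (π.iso.isoM.symm m)) =
    ModelMLFGaloisData.toUnit (ϖ.iso.isoM.symm (f.homM m))
  rw [ModelMLFGaloisData.unitsLift_toUnit, transitionM_apply, MulEquiv.apply_symm_apply]

end GaloisMonoidPair.ModelPresentation

end Literature.AnabelianGeometry.AbsoluteAnabelian

end
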